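import Summits.Langlands.Langlands.Theses.RetentionCarving

/-!
# Glue of the layer-2 split of `MonodromyRetention` (route RetentionCarving, rev 1)

Closes the glue item `stmt-Langlands-29948` of `route-Langlands-RetentionCarving`:
`MonodromyRetention_of_split :
  ThetaAccessibleRetention → ThetaDarkRetention → MonodromyRetention`.
Pure logic — ONE excluded middle on the (inlined) θ-dial of the lens-6 node `ThetaCarving`
(decomp-langlands, 2026-08-30): «π lies in the least θ-saturated class» (every predicate on
automorphic representations containing the self-dual-a.e. representations over totally real fields and
closed under GL₁-twists, contragredients, weak base change up / cuspidal down and weak automorphic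
induction up / cuspidal down holds at π).  A θ-accessible instance of Ret is `ThetaAccessibleRetention`
(A), a θ-dark one is `ThetaDarkRetention` (D).  The dial is never restated: `Classical.em _` is
instantiated by unification against A's hypothesis.  Certified by the critic against the route of record
(CRITIC-LEDGER row 67; writer ROUTE-EDIT rev 1).  No definitions, no new mathematics.
-/

set_option linter.dupNamespace false -- project-wide option; `Summit.Langlands.Langlands` is the mandated namespace

namespace Summit.Langlands.Langlands.Theorems

open Summit.Langlands.Langlands.Theses in
/-- The glue item `stmt-Langlands-29948` of route RetentionCarving (rev 1): the two children
`ThetaAccessibleRetention` (A) and `ThetaDarkRetention` (D) of the split of `MonodromyRetention` (Ret)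
imply the parent.  Proof: after introducing the common frame `K, Rec, n, hcpt, 0 < n, π, π L-algebraic`,
the remaining statement of Ret is the common tail of A and D; excluded middle on the θ-dial picks the
child. -/
theorem MonodromyRetention_of_split_proof :
    Summit.Langlands.Langlands.Theses.RetentionCarving.MonodromyRetention_of_split := by
  intro hA hD K _ _ Rec n hcpt hn π hL
  exact (Classical.em _).elim (hA K Rec n hcpt hn π hL) (hD K Rec n hcpt hn π hL)

end Summit.Langlands.Langlands.Theorems
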